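import Summits.ValiantsHypothesis.ValiantsHypothesis.Theorems.LacunarySymmetroidMatrixDescartesFiniteSectorSectorCeilingMTwoKEightA
import Summits.ValiantsHypothesis.ValiantsHypothesis.Theorems.LacunarySymmetroidMatrixDescartesFiniteSectorSectorCeilingMTwoKEightB
import Summits.ValiantsHypothesis.ValiantsHypothesis.Theorems.LacunarySymmetroidMatrixDescartesFiniteSectorSectorCeilingMTwo

/-!
# `MatrixDescartes` — line «finite»: the SECTOR CEILING `η(2,8) ≤ σ(2,8) = 52` (kernel) — `HypRootLawAt 2 8 52`, Conjecture Σ's value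
# `2·n(2,7)` at the cell `(2,8)`

HONEST FRAMING.  Object-search cell `pub-symmetroid`, seat val-sym-door-p5 g8 (the `m = 2` row of the finite table is this seat's, desk R2488 (A) / R2525 (B)(ii)).
HELPER of the crux item `stmt-ValiantsHypothesis-18050` (`Theses.LacunarySymmetroid.MatrixDescartes`) with NO closure claim.  Continuation of
`…FiniteSectorSectorCeilingMTwo` / `…MTwoKSeven` (`HypRootLawAt 2 K 2·n(2,K−1)` for `K ≤ 7`): the SIEVE of line «finite» (`FiniteSector.sieve`,
`natDegree_mem_sumset`) makes the pair sums `dᵢ + dⱼ` of an in-sector pencil a step-≤-2 chain from `0` up to the degree; the finite core — no `7` positive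
values carry such a chain beyond `52` — has 91350 live prefixes and is decided in the kernel in SLICES by the two smallest positive values `(a,b)`
(`a ∈ {1,2}`, `b ≤ 2a+2` are forced by the chain at `r = 1` and `r = 2a+1`): slices (1,2), (1,3), (1,4), (2,3), (2,4), (2,5) in
`…FiniteSectorSectorCeilingMTwoKEightA`, `…FiniteSectorSectorCeilingMTwoKEightB`, slice(s) (2,6) here, pair sums as shift-form bitmasks
(`…FiniteSectorPairSumMasksShift`).  Result: `hypRootLawAt_two_eight_52 : HypRootLawAt 2 8 52`.  Located first (exact DFS, this seat, HOME/val-sym-door-p5/g8/work/mask/psenum.py):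
the chain survives to `51` only on four value sets (the doubled extremal bases `2·{0,1,3,5,7,8,17,18}`, `2·{0,1,3,4,9,10,12,13}`, `2·{0,1,2,5,8,11,12,13}` and the non-doubled `{0,2,6,10,14,16,33,35}`), and on none of them is `53` a pair sum or are `52` and `54` both pair sums —
`σ(2,8) = 52 = 2·n(2,7)`: Conjecture Σ of `Lines/finite.md` («σ(m,K) = 2·n(m,K−1)») holds at the NEW cell `(2,8)`; the lower side `η(2,8) ≥ 52` needs a realised
doubled `A_7` row and is NOT claimed here.  Nothing here bears on the crux (asymptotic), on `H3`, on the doors, or on `VP ≠ VNP`.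
[folklore] Gap-rule / sieve bookkeeping plus a finite enumeration (two-stamp postage numbers, OEIS A001212); no citation is load-bearing.
-/

-- `Summit.ValiantsHypothesis.ValiantsHypothesis.…` repeats a component by the D-0017 layout
-- (single-conjunct summit), which the `dupNamespace` linter flags; the name is mandated.
set_option linter.dupNamespace false

namespace Summit.ValiantsHypothesis.ValiantsHypothesis.Theorems.LacunarySymmetroidMatrixDescartes.FiniteSector

open scoped BigOperators Matrix
open Polynomial

/-! ## `K = 8`: `σ(2,8) = 52` — last slice and the transfer -/

set_option synthInstance.maxSize 2000000 in
set_option synthInstance.maxHeartbeats 2000000 in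
set_option maxHeartbeats 4000000 in
/-- **Finite core of `σ(2,8) = 52`, slice `(a = 2, b = 6)`** (13100 live prefixes; pruned nested enumeration over the remaining sorted
values `< 56`, pair sums as shift-form bitmasks, `decide` in the kernel): prefix chains alive below the next value and the whole chain reaching `51` force
`53` NOT a pair sum and `52`, `54` not BOTH pair sums. [folklore] -/
theorem sectorCheck_two_eight_s26 :
    ∀ c ∈ List.range 56, (6 < c ∧ ((List.foldr (fun x acc => acc ||| (List.foldr (fun y acc => acc ||| 2 ^ y) 0 [0, 2, 6]) * 2 ^ x) 0 [0, 2, 6] ||| List.foldr (fun x acc => acc ||| (List.foldr (fun y acc => acc ||| 2 ^ y) 0 [0, 2, 6]) * 2 ^ x) 0 [0, 2, 6] / 2) % 2 ^ (min 52 (c - 1)) = 2 ^ (min 52 (c - 1)) - 1)) →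
    ∀ e ∈ List.range 56, (c < e ∧ ((List.foldr (fun x acc => acc ||| (List.foldr (fun y acc => acc ||| 2 ^ y) 0 [0, 2, 6, c]) * 2 ^ x) 0 [0, 2, 6, c] ||| List.foldr (fun x acc => acc ||| (List.foldr (fun y acc => acc ||| 2 ^ y) 0 [0, 2, 6, c]) * 2 ^ x) 0 [0, 2, 6, c] / 2) % 2 ^ (min 52 (e - 1)) = 2 ^ (min 52 (e - 1)) - 1)) →
    ∀ f ∈ List.range 56, (e < f ∧ ((List.foldr (fun x acc => acc ||| (List.foldr (fun y acc => acc ||| 2 ^ y) 0 [0, 2, 6, c, e]) * 2 ^ x) 0 [0, 2, 6, c, e] ||| List.foldr (fun x acc => acc ||| (List.foldr (fun y acc => acc ||| 2 ^ y) 0 [0, 2, 6, c, e]) * 2 ^ x) 0 [0, 2, 6, c, e] / 2) % 2 ^ (min 52 (f - 1)) = 2 ^ (min 52 (f - 1)) - 1)) →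
    ∀ g ∈ List.range 56, (f < g ∧ ((List.foldr (fun x acc => acc ||| (List.foldr (fun y acc => acc ||| 2 ^ y) 0 [0, 2, 6, c, e, f]) * 2 ^ x) 0 [0, 2, 6, c, e, f] ||| List.foldr (fun x acc => acc ||| (List.foldr (fun y acc => acc ||| 2 ^ y) 0 [0, 2, 6, c, e, f]) * 2 ^ x) 0 [0, 2, 6, c, e, f] / 2) % 2 ^ (min 52 (g - 1)) = 2 ^ (min 52 (g - 1)) - 1)) →
    ∀ k ∈ List.range 56, (g < k ∧ ((List.foldr (fun x acc => acc ||| (List.foldr (fun y acc => acc ||| 2 ^ y) 0 [0, 2, 6, c, e, f, g]) * 2 ^ x) 0 [0, 2, 6, c, e, f, g] ||| List.foldr (fun x acc => acc ||| (List.foldr (fun y acc => acc ||| 2 ^ y) 0 [0, 2, 6, c, e, f, g]) * 2 ^ x) 0 [0, 2, 6, c, e, f, g] / 2) % 2 ^ (min 52 (k - 1)) = 2 ^ (min 52 (k - 1)) - 1)) →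
    (((List.foldr (fun x acc => acc ||| (List.foldr (fun y acc => acc ||| 2 ^ y) 0 [0, 2, 6, c, e, f, g, k]) * 2 ^ x) 0 [0, 2, 6, c, e, f, g, k] ||| List.foldr (fun x acc => acc ||| (List.foldr (fun y acc => acc ||| 2 ^ y) 0 [0, 2, 6, c, e, f, g, k]) * 2 ^ x) 0 [0, 2, 6, c, e, f, g, k] / 2) % 2 ^ 52 = 2 ^ 52 - 1) →
      ((List.foldr (fun x acc => acc ||| (List.foldr (fun y acc => acc ||| 2 ^ y) 0 [0, 2, 6, c, e, f, g, k]) * 2 ^ x) 0 [0, 2, 6, c, e, f, g, k]).testBit 53 = false ∧ ((List.foldr (fun x acc => acc ||| (List.foldr (fun y acc => acc ||| 2 ^ y) 0 [0, 2, 6, c, e, f, g, k]) * 2 ^ x) 0 [0, 2, 6, c, e, f, g, k]).testBit 52 = false ∨ (List.foldr (fun x acc => acc ||| (List.foldr (fun y acc => acc ||| 2 ^ y) 0 [0, 2, 6, c, e, f, g, k]) * 2 ^ x) 0 [0, 2, 6, c, e, f, g, k]).testBit 54 = false))) := by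
  decide +kernel

/-- **`η(2,8) ≤ 52 = σ(2,8)`** — `HypRootLawAt 2 8 52`: every in-sector (`#distinct real roots = natDegree`) determinant of a real symmetric
`2 × 2` lacunary pencil with `8` terms has degree `≤ 52`.  (SIEVE ⇒ pair-sum chain; values capped at `55`, value set padded to `8` distinct
values and sorted; `a ≤ 2`, `b ≤ 2a + 2` from the chain at `1` and `2a+1`; prefix pruning `memP_prefix`; shift-form masks; the seven slice checks.) [folklore] -/
theorem hypRootLawAt_two_eight_52 : HypRootLawAt 2 8 52 := by
  intro d S hS hsec
  by_contra hdeg'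
  have hdeg : 52 < (pencil d S).det.natDegree := not_le.mp hdeg'
  have hq : (pencil d S).det ≠ 0 := by
    intro h0
    rw [h0] at hdeg
    simp at hdeg
  -- pair sums of exponents
  have hpair : ∀ r, r ∈ (Finset.univ : Finset (Sym (Fin 8) 2)).image
      (fun s : Sym (Fin 8) 2 => ((s : Multiset (Fin 8)).map d).sum) → ∃ i j : Fin 8, d i + d j = r := by
    intro r hr
    rw [Finset.mem_image] at hr
    obtain ⟨s, -, hs⟩ := hr
    have hcard2 : Multiset.card (s : Multiset (Fin 8)) = 2 := s.2
    obtain ⟨i, j, hij⟩ := Multiset.card_eq_two.mp hcard2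
    refine ⟨i, j, ?_⟩
    have hsum : ((s : Multiset (Fin 8)).map d).sum = d i + d j := by
      rw [hij]
      simp
    omega
  have hchain : ∀ r, r + 2 ≤ (pencil d S).det.natDegree →
      (∃ i j : Fin 8, d i + d j = r) ∨ (∃ i j : Fin 8, d i + d j = r + 1) := by
    intro r hr
    rcases sieve d S hq hsec hr with h | h
    · exact Or.inl (hpair _ h)
    · exact Or.inr (hpair _ h)
  have htop : ∃ i j : Fin 8, d i + d j = (pencil d S).det.natDegree := hpair _ (natDegree_mem_sumset d S hq)
  -- capped values, the value set, padding, sorting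
  set cv : Fin 8 → ℕ := fun i => min (d i) 55 with hcv
  have hcvd : ∀ i, d i ≤ 54 → cv i = d i := fun i hi => by
    simp only [hcv]
    exact Nat.min_eq_left (by omega)
  have hcvle : ∀ i, cv i ≤ 55 := fun i => Nat.min_le_right _ _
  set V : Finset ℕ := Finset.univ.image cv with hV
  have hcvV : ∀ i, cv i ∈ V := fun i => Finset.mem_image_of_mem cv (Finset.mem_univ i)
  have h0V : 0 ∈ V := by
    rcases hchain 0 (by omega) with ⟨i, j, hij⟩ | ⟨i, j, hij⟩
    · have : cv i = 0 := by rw [hcvd i (by omega)]; omega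
      exact this ▸ hcvV i
    · rcases Nat.eq_zero_or_pos (d i) with hi | hi
      · have : cv i = 0 := by rw [hcvd i (by omega)]; omega
        exact this ▸ hcvV i
      · have : cv j = 0 := by rw [hcvd j (by omega)]; omega
        exact this ▸ hcvV j
  set W : Finset ℕ := V.erase 0 with hW
  have hWsub : W ⊆ (Finset.range 56).erase 0 := by
    intro u hu
    rw [hW, Finset.mem_erase] at hu
    obtain ⟨hu0, huV⟩ := hu
    rw [hV, Finset.mem_image] at huV
    obtain ⟨i, -, rfl⟩ := huV
    rw [Finset.mem_erase, Finset.mem_range]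
    exact ⟨hu0, Nat.lt_succ_of_le (hcvle i)⟩
  have hWcard : W.card ≤ 7 := by
    have hVK : V.card ≤ 8 := by
      have := Finset.card_image_le (s := (Finset.univ : Finset (Fin 8))) (f := cv)
      simpa using this
    have h1 : W.card + 1 = V.card := by rw [hW]; exact Finset.card_erase_add_one h0V
    omega
  obtain ⟨W', hWW', hW'sub, hW'card⟩ := Finset.exists_subsuperset_card_eq hWsub hWcard
    (by rw [Finset.card_erase_of_mem (by simp), Finset.card_range]; omega)
  have hVW' : ∀ u ∈ V, u = 0 ∨ u ∈ W' := by
    intro u hu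
    by_cases hu0 : u = 0
    · exact Or.inl hu0
    · exact Or.inr (hWW' (by rw [hW, Finset.mem_erase]; exact ⟨hu0, hu⟩))
  have hlmem : ∀ u, u ∈ Finset.sort W' ↔ u ∈ W' := fun u => Finset.mem_sort _
  have hlsort : (Finset.sort W').SortedLT := Finset.sortedLT_sort W'
  have hllen : (Finset.sort W').length = 7 := by rw [Finset.length_sort, hW'card]
  generalize hl : Finset.sort W' = l at hlmem hlsort hllen
  -- name the sorted values
  rcases l with _ | ⟨a, _ | ⟨b, _ | ⟨c, _ | ⟨e, _ | ⟨f, _ | ⟨g, _ | ⟨k, _ | ⟨zz, ll⟩⟩⟩⟩⟩⟩⟩⟩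
  all_goals simp only [List.length_cons, List.length_nil] at hllen
  all_goals try omega
  -- bounds and order
  have hmemR : ∀ u, u ∈ [a, b, c, e, f, g, k] → u ∈ List.range 56 := by
    intro u hu
    have hu' : u ∈ W' := (hlmem u).mp hu
    have := hW'sub hu'
    rw [Finset.mem_erase, Finset.mem_range] at this
    exact List.mem_range.mpr this.2
  have hne0 : ∀ u, u ∈ [a, b, c, e, f, g, k] → u ≠ 0 := by
    intro u hu
    have hu' : u ∈ W' := (hlmem u).mp hu
    have := hW'sub hu'
    rw [Finset.mem_erase] at this
    exact this.1
  have h0 : 0 < a := Nat.pos_of_ne_zero (hne0 a (by simp))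
  -- membership transfer: a pair sum `r ≤ 54` of `d` is a pair sum of the sorted value list
  have hmemP : ∀ r, r ≤ 54 → (∃ i j : Fin 8, d i + d j = r) → (∃ x ∈ [0, a, b, c, e, f, g, k], ∃ y ∈ [0, a, b, c, e, f, g, k], x + y = r) := by
    rintro r hr ⟨i, j, hij⟩
    have hi : cv i = d i := hcvd i (by omega)
    have hj : cv j = d j := hcvd j (by omega)
    have hin : ∀ u ∈ V, u ∈ [0, a, b, c, e, f, g, k] := by
      intro u hu
      rcases hVW' u hu with h | h
      · rw [h]; simp
      · exact List.mem_cons_of_mem _ ((hlmem u).mpr h)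
    exact ⟨cv i, hin _ (hcvV i), cv j, hin _ (hcvV j), by rw [hi, hj]; exact hij⟩
  have hchainP : ∀ r, r ≤ 51 → (∃ x ∈ [0, a, b, c, e, f, g, k], ∃ y ∈ [0, a, b, c, e, f, g, k], x + y = r) ∨ (∃ x ∈ [0, a, b, c, e, f, g, k], ∃ y ∈ [0, a, b, c, e, f, g, k], x + y = r + 1) := by
    intro r hr
    rcases hchain r (by omega) with h | h
    · exact Or.inl (hmemP r (by omega) h)
    · exact Or.inr (hmemP (r + 1) (by omega) h)
  have hfull : ((List.foldr (fun x acc => acc ||| (List.foldr (fun y acc => acc ||| 2 ^ y) 0 [0, a, b, c, e, f, g, k]) * 2 ^ x) 0 [0, a, b, c, e, f, g, k] ||| List.foldr (fun x acc => acc ||| (List.foldr (fun y acc => acc ||| 2 ^ y) 0 [0, a, b, c, e, f, g, k]) * 2 ^ x) 0 [0, a, b, c, e, f, g, k] / 2) % 2 ^ 52 = 2 ^ 52 - 1) := by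
    apply maskAlive_of_testBit
    intro r hr
    rcases hchainP r (by omega) with h | h
    · exact Or.inl (testBit_pairFoldShift_of_mem h)
    · exact Or.inr (testBit_pairFoldShift_of_mem h)
  have hlt1 : a < b := by
    have := hlsort (show (⟨0, by simp⟩ : Fin [a, b, c, e, f, g, k].length) < ⟨1, by simp⟩ from Fin.mk_lt_mk.mpr (by norm_num))
    simpa using this
  have hlt2 : b < c := by
    have := hlsort (show (⟨1, by simp⟩ : Fin [a, b, c, e, f, g, k].length) < ⟨2, by simp⟩ from Fin.mk_lt_mk.mpr (by norm_num))
    simpa using this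
  have hlt3 : c < e := by
    have := hlsort (show (⟨2, by simp⟩ : Fin [a, b, c, e, f, g, k].length) < ⟨3, by simp⟩ from Fin.mk_lt_mk.mpr (by norm_num))
    simpa using this
  have hlt4 : e < f := by
    have := hlsort (show (⟨3, by simp⟩ : Fin [a, b, c, e, f, g, k].length) < ⟨4, by simp⟩ from Fin.mk_lt_mk.mpr (by norm_num))
    simpa using this
  have hlt5 : f < g := by
    have := hlsort (show (⟨4, by simp⟩ : Fin [a, b, c, e, f, g, k].length) < ⟨5, by simp⟩ from Fin.mk_lt_mk.mpr (by norm_num))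
    simpa using this
  have hlt6 : g < k := by
    have := hlsort (show (⟨5, by simp⟩ : Fin [a, b, c, e, f, g, k].length) < ⟨6, by simp⟩ from Fin.mk_lt_mk.mpr (by norm_num))
    simpa using this
  -- the two smallest positive values: `a ≤ 2` (chain at `1`) and `b ≤ 2a + 2` (chain at `2a + 1`)
  have hrestA : ∀ y ∈ [a, b, c, e, f, g, k], a ≤ y := by
    intro y hy
    simp only [List.mem_cons, List.mem_nil_iff, or_false] at hy
    omega
  have hrestB : ∀ y ∈ [b, c, e, f, g, k], b ≤ y := by
    intro y hy
    simp only [List.mem_cons, List.mem_nil_iff, or_false] at hy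
    omega
  have ha2 : a ≤ 2 := by
    by_contra hh
    rcases hchainP 1 (by omega) with h | h
    · obtain ⟨x, hx, y, hy, hxy⟩ := memP_prefix (l₁ := [0]) (l₂ := [a, b, c, e, f, g, k]) hrestA (by omega) h
      simp only [List.mem_cons, List.mem_nil_iff, or_false] at hx hy
      omega
    · obtain ⟨x, hx, y, hy, hxy⟩ := memP_prefix (l₁ := [0]) (l₂ := [a, b, c, e, f, g, k]) hrestA (by omega) h
      simp only [List.mem_cons, List.mem_nil_iff, or_false] at hx hy
      omega
  have hb2 : b ≤ 2 * a + 2 := by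
    by_contra hh
    rcases hchainP (2 * a + 1) (by omega) with h | h
    · obtain ⟨x, hx, y, hy, hxy⟩ := memP_prefix (l₁ := [0, a]) (l₂ := [b, c, e, f, g, k]) hrestB (by omega) h
      simp only [List.mem_cons, List.mem_nil_iff, or_false] at hx hy
      rcases hx with rfl | rfl <;> rcases hy with rfl | rfl <;> omega
    · obtain ⟨x, hx, y, hy, hxy⟩ := memP_prefix (l₁ := [0, a]) (l₂ := [b, c, e, f, g, k]) hrestB (by omega) h
      simp only [List.mem_cons, List.mem_nil_iff, or_false] at hx hy
      rcases hx with rfl | rfl <;> rcases hy with rfl | rfl <;> omega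
  have pre3 : ((List.foldr (fun x acc => acc ||| (List.foldr (fun y acc => acc ||| 2 ^ y) 0 [0, a, b]) * 2 ^ x) 0 [0, a, b] ||| List.foldr (fun x acc => acc ||| (List.foldr (fun y acc => acc ||| 2 ^ y) 0 [0, a, b]) * 2 ^ x) 0 [0, a, b] / 2) % 2 ^ (min 52 (c - 1)) = 2 ^ (min 52 (c - 1)) - 1) := by
    apply maskAlive_of_testBit
    intro r hr
    have hrT : r < 52 := lt_of_lt_of_le hr (min_le_left _ _)
    have hrv : r < c - 1 := lt_of_lt_of_le hr (min_le_right _ _)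
    have hr' : r + 1 < c := by omega
    have hrest : ∀ y ∈ [c, e, f, g, k], c ≤ y := by
      intro y hy
      simp only [List.mem_cons, List.mem_nil_iff, or_false] at hy
      omega
    rcases hchainP r (by omega) with h | h
    · exact Or.inl (testBit_pairFoldShift_of_mem (memP_prefix (l₁ := [0, a, b]) (l₂ := [c, e, f, g, k]) hrest (by omega) h))
    · exact Or.inr (testBit_pairFoldShift_of_mem (memP_prefix (l₁ := [0, a, b]) (l₂ := [c, e, f, g, k]) hrest hr' h))
  have pre4 : ((List.foldr (fun x acc => acc ||| (List.foldr (fun y acc => acc ||| 2 ^ y) 0 [0, a, b, c]) * 2 ^ x) 0 [0, a, b, c] ||| List.foldr (fun x acc => acc ||| (List.foldr (fun y acc => acc ||| 2 ^ y) 0 [0, a, b, c]) * 2 ^ x) 0 [0, a, b, c] / 2) % 2 ^ (min 52 (e - 1)) = 2 ^ (min 52 (e - 1)) - 1) := by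
    apply maskAlive_of_testBit
    intro r hr
    have hrT : r < 52 := lt_of_lt_of_le hr (min_le_left _ _)
    have hrv : r < e - 1 := lt_of_lt_of_le hr (min_le_right _ _)
    have hr' : r + 1 < e := by omega
    have hrest : ∀ y ∈ [e, f, g, k], e ≤ y := by
      intro y hy
      simp only [List.mem_cons, List.mem_nil_iff, or_false] at hy
      omega
    rcases hchainP r (by omega) with h | h
    · exact Or.inl (testBit_pairFoldShift_of_mem (memP_prefix (l₁ := [0, a, b, c]) (l₂ := [e, f, g, k]) hrest (by omega) h))
    · exact Or.inr (testBit_pairFoldShift_of_mem (memP_prefix (l₁ := [0, a, b, c]) (l₂ := [e, f, g, k]) hrest hr' h))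
  have pre5 : ((List.foldr (fun x acc => acc ||| (List.foldr (fun y acc => acc ||| 2 ^ y) 0 [0, a, b, c, e]) * 2 ^ x) 0 [0, a, b, c, e] ||| List.foldr (fun x acc => acc ||| (List.foldr (fun y acc => acc ||| 2 ^ y) 0 [0, a, b, c, e]) * 2 ^ x) 0 [0, a, b, c, e] / 2) % 2 ^ (min 52 (f - 1)) = 2 ^ (min 52 (f - 1)) - 1) := by
    apply maskAlive_of_testBit
    intro r hr
    have hrT : r < 52 := lt_of_lt_of_le hr (min_le_left _ _)
    have hrv : r < f - 1 := lt_of_lt_of_le hr (min_le_right _ _)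
    have hr' : r + 1 < f := by omega
    have hrest : ∀ y ∈ [f, g, k], f ≤ y := by
      intro y hy
      simp only [List.mem_cons, List.mem_nil_iff, or_false] at hy
      omega
    rcases hchainP r (by omega) with h | h
    · exact Or.inl (testBit_pairFoldShift_of_mem (memP_prefix (l₁ := [0, a, b, c, e]) (l₂ := [f, g, k]) hrest (by omega) h))
    · exact Or.inr (testBit_pairFoldShift_of_mem (memP_prefix (l₁ := [0, a, b, c, e]) (l₂ := [f, g, k]) hrest hr' h))
  have pre6 : ((List.foldr (fun x acc => acc ||| (List.foldr (fun y acc => acc ||| 2 ^ y) 0 [0, a, b, c, e, f]) * 2 ^ x) 0 [0, a, b, c, e, f] ||| List.foldr (fun x acc => acc ||| (List.foldr (fun y acc => acc ||| 2 ^ y) 0 [0, a, b, c, e, f]) * 2 ^ x) 0 [0, a, b, c, e, f] / 2) % 2 ^ (min 52 (g - 1)) = 2 ^ (min 52 (g - 1)) - 1) := by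
    apply maskAlive_of_testBit
    intro r hr
    have hrT : r < 52 := lt_of_lt_of_le hr (min_le_left _ _)
    have hrv : r < g - 1 := lt_of_lt_of_le hr (min_le_right _ _)
    have hr' : r + 1 < g := by omega
    have hrest : ∀ y ∈ [g, k], g ≤ y := by
      intro y hy
      simp only [List.mem_cons, List.mem_nil_iff, or_false] at hy
      omega
    rcases hchainP r (by omega) with h | h
    · exact Or.inl (testBit_pairFoldShift_of_mem (memP_prefix (l₁ := [0, a, b, c, e, f]) (l₂ := [g, k]) hrest (by omega) h))
    · exact Or.inr (testBit_pairFoldShift_of_mem (memP_prefix (l₁ := [0, a, b, c, e, f]) (l₂ := [g, k]) hrest hr' h))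
  have pre7 : ((List.foldr (fun x acc => acc ||| (List.foldr (fun y acc => acc ||| 2 ^ y) 0 [0, a, b, c, e, f, g]) * 2 ^ x) 0 [0, a, b, c, e, f, g] ||| List.foldr (fun x acc => acc ||| (List.foldr (fun y acc => acc ||| 2 ^ y) 0 [0, a, b, c, e, f, g]) * 2 ^ x) 0 [0, a, b, c, e, f, g] / 2) % 2 ^ (min 52 (k - 1)) = 2 ^ (min 52 (k - 1)) - 1) := by
    apply maskAlive_of_testBit
    intro r hr
    have hrT : r < 52 := lt_of_lt_of_le hr (min_le_left _ _)
    have hrv : r < k - 1 := lt_of_lt_of_le hr (min_le_right _ _)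
    have hr' : r + 1 < k := by omega
    have hrest : ∀ y ∈ [k], k ≤ y := by
      intro y hy
      simp only [List.mem_cons, List.mem_nil_iff, or_false] at hy
      omega
    rcases hchainP r (by omega) with h | h
    · exact Or.inl (testBit_pairFoldShift_of_mem (memP_prefix (l₁ := [0, a, b, c, e, f, g]) (l₂ := [k]) hrest (by omega) h))
    · exact Or.inr (testBit_pairFoldShift_of_mem (memP_prefix (l₁ := [0, a, b, c, e, f, g]) (l₂ := [k]) hrest hr' h))
  -- apply the kernel checks, slice by slice
  obtain ⟨hnoT1, hnoT0T2⟩ :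
      ((List.foldr (fun x acc => acc ||| (List.foldr (fun y acc => acc ||| 2 ^ y) 0 [0, a, b, c, e, f, g, k]) * 2 ^ x) 0 [0, a, b, c, e, f, g, k]).testBit 53 = false ∧ ((List.foldr (fun x acc => acc ||| (List.foldr (fun y acc => acc ||| 2 ^ y) 0 [0, a, b, c, e, f, g, k]) * 2 ^ x) 0 [0, a, b, c, e, f, g, k]).testBit 52 = false ∨ (List.foldr (fun x acc => acc ||| (List.foldr (fun y acc => acc ||| 2 ^ y) 0 [0, a, b, c, e, f, g, k]) * 2 ^ x) 0 [0, a, b, c, e, f, g, k]).testBit 54 = false)) := by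
    interval_cases a <;> interval_cases b <;> first | exact sectorCheck_two_eight_s12 c (hmemR c (by simp)) ⟨hlt2, pre3⟩ e (hmemR e (by simp)) ⟨hlt3, pre4⟩ f (hmemR f (by simp)) ⟨hlt4, pre5⟩ g (hmemR g (by simp)) ⟨hlt5, pre6⟩ k (hmemR k (by simp)) ⟨hlt6, pre7⟩ hfull | exact sectorCheck_two_eight_s13 c (hmemR c (by simp)) ⟨hlt2, pre3⟩ e (hmemR e (by simp)) ⟨hlt3, pre4⟩ f (hmemR f (by simp)) ⟨hlt4, pre5⟩ g (hmemR g (by simp)) ⟨hlt5, pre6⟩ k (hmemR k (by simp)) ⟨hlt6, pre7⟩ hfull | exact sectorCheck_two_eight_s14 c (hmemR c (by simp)) ⟨hlt2, pre3⟩ e (hmemR e (by simp)) ⟨hlt3, pre4⟩ f (hmemR f (by simp)) ⟨hlt4, pre5⟩ g (hmemR g (by simp)) ⟨hlt5, pre6⟩ k (hmemR k (by simp)) ⟨hlt6, pre7⟩ hfull | exact sectorCheck_two_eight_s23 c (hmemR c (by simp)) ⟨hlt2, pre3⟩ e (hmemR e (by simp)) ⟨hlt3, pre4⟩ f (hmemR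 f (by simp)) ⟨hlt4, pre5⟩ g (hmemR g (by simp)) ⟨hlt5, pre6⟩ k (hmemR k (by simp)) ⟨hlt6, pre7⟩ hfull | exact sectorCheck_two_eight_s24 c (hmemR c (by simp)) ⟨hlt2, pre3⟩ e (hmemR e (by simp)) ⟨hlt3, pre4⟩ f (hmemR f (by simp)) ⟨hlt4, pre5⟩ g (hmemR g (by simp)) ⟨hlt5, pre6⟩ k (hmemR k (by simp)) ⟨hlt6, pre7⟩ hfull | exact sectorCheck_two_eight_s25 c (hmemR c (by simp)) ⟨hlt2, pre3⟩ e (hmemR e (by simp)) ⟨hlt3, pre4⟩ f (hmemR f (by simp)) ⟨hlt4, pre5⟩ g (hmemR g (by simp)) ⟨hlt5, pre6⟩ k (hmemR k (by simp)) ⟨hlt6, pre7⟩ hfull | exact sectorCheck_two_eight_s26 c (hmemR c (by simp)) ⟨hlt2, pre3⟩ e (hmemR e (by simp)) ⟨hlt3, pre4⟩ f (hmemR f (by simp)) ⟨hlt4, pre5⟩ g (hmemR g (by simp)) ⟨hlt5, pre6⟩ k (hmemR k (by simp)) ⟨hlt6, pre7⟩ hfull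
  -- bit tests back to membership
  have hbit : ∀ r, r ≤ 54 → (∃ i j : Fin 8, d i + d j = r) → (List.foldr (fun x acc => acc ||| (List.foldr (fun y acc => acc ||| 2 ^ y) 0 [0, a, b, c, e, f, g, k]) * 2 ^ x) 0 [0, a, b, c, e, f, g, k]).testBit r = true :=
    fun r hr h => testBit_pairFoldShift_of_mem (hmemP r hr h)
  have hcontra : ∀ r, r ≤ 54 → (∃ i j : Fin 8, d i + d j = r) → (List.foldr (fun x acc => acc ||| (List.foldr (fun y acc => acc ||| 2 ^ y) 0 [0, a, b, c, e, f, g, k]) * 2 ^ x) 0 [0, a, b, c, e, f, g, k]).testBit r = false → False := by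
    intro r hr h hf
    have hb := hbit r hr h
    rw [hf] at hb
    exact Bool.false_ne_true hb
  -- degree 53, 54, or ≥ 55: each contradicts the check
  rcases Nat.lt_or_ge (pencil d S).det.natDegree 55 with hsmall | hbig
  · interval_cases h : (pencil d S).det.natDegree
    · exact hcontra 53 (by omega) (h ▸ htop) hnoT1
    · rcases hchain 52 (by omega) with h' | h'
      · rcases hnoT0T2 with hf | hf
        · exact hcontra 52 (by omega) h' hf
        · exact hcontra 54 (by omega) (h ▸ htop) hf
      · exact hcontra 53 (by omega) h' hnoT1
  · rcases hchain 52 (by omega) with h1 | h1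
    · rcases hchain 53 (by omega) with h2 | h2
      · exact hcontra 53 (by omega) h2 hnoT1
      · rcases hnoT0T2 with hf | hf
        · exact hcontra 52 (by omega) h1 hf
        · exact hcontra 54 (by omega) h2 hf
    · exact hcontra 53 (by omega) h1 hnoT1

end Summit.ValiantsHypothesis.ValiantsHypothesis.Theorems.LacunarySymmetroidMatrixDescartes.FiniteSector
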